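import Literature.NumberTheory.Transcendental.HolonomyBoundModule
import Mathlib.Analysis.Calculus.SmoothSeries
import Mathlib.Analysis.Calculus.Deriv.Pow
import Mathlib.Analysis.Calculus.Deriv.Inv
import Mathlib.Analysis.SpecificLimits.Normed
import Mathlib.Analysis.Complex.CauchyIntegral
import Mathlib.Analysis.Normed.Module.Convex
import Mathlib.Tactic
import HarnessLib

/-!
# André's arithmetic holonomicity criterion (CDT Corollary 10)

Calegari–Dimitrov–Tang, arXiv:2408.15403, §2.6 (p. 12), Corollary 10 (attributed to André,
*G-functions and geometry* [Andre1989]; cf. Perelli–Zannier): "If a formal function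
`f ∈ ℚ⟦x⟧` has rational coefficients of the form `f(x) = Σ_n a_n xⁿ/([1,…,b₁n]⋯[1,…,b_r n])`,
`a_n ∈ ℤ`, and admits an analytic mapping `φ : (D, 0) → (ℂ, 0)` with conformal size
`|φ'(0)| > e^{b₁+⋯+b_r}` and such that the composite function germ `f(φ(z)) ∈ ℂ⟦z⟧` is the
germ of a meromorphic function on `D`, then `f(x)` is a holonomic function: there exists a
nonzero linear differential operator `L` with `ℚ[x]`-coefficients that satisfies `L(f) = 0`."
It is "a crude qualitative corollary" of the basic holonomy bound (Theorem 9 / Appendix (17.1)).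

This file derives it from `holonomyBound_nevanlinna_meromorphic'` (the basic bound of this
directory, eq. (17.1)), in that theorem's analytic format: `ψ` analytic on a disc `|z| < R₀`,
`R₀ > 1`, `ψ(0) = 0`, and `f(ψ(z)) = G(z)/h(z)` near `0` with `G, h` analytic on the disc and
`h(0) = 1` (from the open unit disc one rescales `z ↦ ψ(rz)`, `r ↑ 1`, keeping
`|ψ'(0)| r > e^{Σ b_j}`). The derivation: the Euler derivatives `θ^i f`, `θ = x d/dx`, have the
same denominator type (`a_n ↦ nⁱ a_n`); their pullbacks are `P_i(ψ(z))`, `P_i(w) = Σ nⁱ c_n wⁿ`,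
and satisfy `g_{i+1} = ψ g_i'/ψ'` (termwise differentiation inside the disc of convergence,
`w P_i'(w) = P_{i+1}(w)`), so `g_i = N_i/E_i` near `0` with `N_{i+1} = ψ(N_i'E_i − N_iE_i')`,
`E_{i+1} = E_i² ψ'` analytic on the big disc and `E_i(0) ≠ 0`; with the common denominator
`H = Π E_j/E_j(0)` the bound applies to any `ℚ(x)`-independent subfamily `(θ^i f)_{i<m}` and
gives `m (log|ψ'(0)| − Σ b_j) ≤ 2 T(ψ)`, so `(θ^i f)_{i<m}` is dependent for
`m > 2T(ψ)/(log|ψ'(0)| − Σ b_j)`.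

* `summable_pow_mul_norm_mul_pow`, `hasDerivAt_tsum_mul_pow`, `mul_deriv_tsum_mul_pow` —
  power series calculus strictly inside the disc of convergence (`θ P = Σ n c_n wⁿ`).
* `eulerSeries`, `eulerPull`, `eventually_eulerPull_succ`, `eulerPull_succ_rep`, `repSeq`,
  `repSeq_spec` — the recursion for the pullbacks of `θ^i f`.
* `exists_radius_of_germ` — a positive radius from the germ hypothesis.
* `eulerOp` (`θ` on `ℚ⟦x⟧`), `IsHolonomic` (`isHolonomic_iff_exists_ode`: a nontrivial ODE
  `Σ Pᵢ θ^i F = 0` with polynomial coefficients), `fser_eulerFamily`.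
* `eulerFamily_bound` — the bound for the Euler family; `andre_holonomicity_criterion` —
  **CDT Corollary 10**; `andre_holonomicity_criterion_unitDisc` — the same for `ψ` on the open
  unit disc (the printed form), by the rescaling `z ↦ ψ(ϱz)`.

No named facts.

## References

* [CalegariDimitrovTang2024] arXiv:2408.15403, §2.6 Corollary 10 (p. 12); Appendix §17.
* [Andre1989] Y. André, G-Functions and Geometry, Vieweg 1989.
-/

noncomputable section

open Filter Topology Metric Set PowerSeries Real

namespace Literature.NumberTheory.Transcendental

namespace HolonomyBound

/-! ## Power series inside the disc of convergence: weights `k^i` and the Euler operator -/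

/-- Polynomial weights do not spoil convergence strictly inside: if `Σ ‖c_k‖ ρ^k < ∞` and
`0 ≤ ρ' < ρ` then `Σ k^i ‖c_k‖ ρ'^k < ∞`. [folklore] -/
theorem summable_pow_mul_norm_mul_pow {c : ℕ → ℂ} {ρ ρ' : ℝ} (hρ' : 0 ≤ ρ') (h : ρ' < ρ)
    (hs : Summable fun k => ‖c k‖ * ρ ^ k) (i : ℕ) :
    Summable fun k : ℕ => (k : ℝ) ^ i * ‖c k‖ * ρ' ^ k := by
  have hρ : 0 < ρ := lt_of_le_of_lt hρ' h
  set q : ℝ := ρ' / ρ with hq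
  have hq0 : 0 ≤ q := div_nonneg hρ' hρ.le
  have hq1 : q < 1 := (div_lt_one hρ).mpr h
  have hlim : Tendsto (fun k : ℕ => (k : ℝ) ^ i * q ^ k) atTop (𝓝 0) :=
    tendsto_pow_const_mul_const_pow_of_abs_lt_one i (by rw [abs_of_nonneg hq0]; exact hq1)
  have hev : ∀ᶠ k : ℕ in atTop, (k : ℝ) ^ i * q ^ k ≤ 1 :=
    (hlim.eventually (Iic_mem_nhds one_pos)).mono fun k hk => hk
  refine Summable.of_norm_bounded_eventually_nat hs ?_
  filter_upwards [hev] with k hk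
  rw [Real.norm_of_nonneg (by positivity)]
  have hρk : ρ' ^ k = ρ ^ k * q ^ k := by
    rw [hq, div_pow, mul_div_cancel₀ _ (pow_ne_zero _ hρ.ne')]
  rw [hρk]
  have h1 : 0 ≤ ‖c k‖ * ρ ^ k := by positivity
  calc (k : ℝ) ^ i * ‖c k‖ * (ρ ^ k * q ^ k) = (‖c k‖ * ρ ^ k) * ((k : ℝ) ^ i * q ^ k) := by ring
    _ ≤ (‖c k‖ * ρ ^ k) * 1 := mul_le_mul_of_nonneg_left hk h1
    _ = ‖c k‖ * ρ ^ k := mul_one _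

/-- Inside the disc: `Σ k^i c_k w^k` converges (absolutely). [folklore] -/
theorem summable_pow_mul_mul_pow {c : ℕ → ℂ} {ρ : ℝ} (hs : Summable fun k => ‖c k‖ * ρ ^ k)
    (i : ℕ) {w : ℂ} (hw : ‖w‖ < ρ) :
    Summable fun k : ℕ => (k : ℂ) ^ i * c k * w ^ k := by
  refine Summable.of_norm ?_
  have := summable_pow_mul_norm_mul_pow (norm_nonneg w) hw hs i
  refine this.congr fun k => ?_
  rw [norm_mul, norm_mul, norm_pow, norm_pow, Complex.norm_natCast]

/-- **Termwise differentiation** of `P(z) = Σ c_k z^k` strictly inside the disc of (absolute)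
convergence. [folklore] -/
theorem hasDerivAt_tsum_mul_pow {c : ℕ → ℂ} {ρ : ℝ} (hs : Summable fun k => ‖c k‖ * ρ ^ k)
    {w : ℂ} (hw : ‖w‖ < ρ) :
    HasDerivAt (fun z => ∑' k, c k * z ^ k) (∑' k, c k * ((k : ℂ) * w ^ (k - 1))) w := by
  -- an intermediate radius `‖w‖ < ρ' < ρ`, `ρ' > 0`
  obtain ⟨ρ', hwρ', hρ'ρ⟩ := exists_between (max_lt hw (lt_of_le_of_lt (norm_nonneg w) hw))
  have hρ'0 : 0 < ρ' := lt_of_le_of_lt (le_max_right _ _) hwρ'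
  have hw' : ‖w‖ < ρ' := lt_of_le_of_lt (le_max_left _ _) hwρ'
  set u : ℕ → ℝ := fun k : ℕ => (k : ℝ) ^ 1 * ‖c k‖ * ρ' ^ k / ρ' with hu
  have hus : Summable u := (summable_pow_mul_norm_mul_pow hρ'0.le hρ'ρ hs 1).div_const ρ'
  refine hasDerivAt_tsum_of_isPreconnected hus isOpen_ball (convex_ball (0 : ℂ) ρ').isPreconnected
    (g := fun k z => c k * z ^ k) (g' := fun k z => c k * ((k : ℂ) * z ^ (k - 1)))
    (fun k z _ => (hasDerivAt_pow k z).const_mul (c k)) ?_ (mem_ball_self hρ'0) ?_ ?_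
  · -- the derivative bound on the ball
    intro k z hz
    rw [mem_ball_zero_iff] at hz
    rw [norm_mul, norm_mul, norm_pow, Complex.norm_natCast, hu]
    simp only [pow_one]
    rcases Nat.eq_zero_or_pos k with rfl | hk
    · simp
    · have h1 : ‖z‖ ^ (k - 1) ≤ ρ' ^ (k - 1) := pow_le_pow_left₀ (norm_nonneg _) hz.le _
      have h2 : ρ' ^ (k - 1) = ρ' ^ k / ρ' := by
        rw [eq_div_iff hρ'0.ne', ← pow_succ, Nat.sub_add_cancel hk]
      calc ‖c k‖ * ((k : ℝ) * ‖z‖ ^ (k - 1)) ≤ ‖c k‖ * ((k : ℝ) * ρ' ^ (k - 1)) := by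
            gcongr
        _ = (k : ℝ) * ‖c k‖ * ρ' ^ k / ρ' := by rw [h2]; ring
  · exact (summable_pow_mul_mul_pow hs 0 (show ‖(0 : ℂ)‖ < ρ by
      rw [norm_zero]; exact hρ'0.trans hρ'ρ)).congr fun k => by simp
  · rwa [mem_ball_zero_iff]

/-- **The Euler operator `θ = w d/dw` on power series**: `w · P'(w) = Σ k c_k w^k` inside the
disc. [folklore] -/
theorem mul_deriv_tsum_mul_pow {c : ℕ → ℂ} {ρ : ℝ} (hs : Summable fun k => ‖c k‖ * ρ ^ k)
    {w : ℂ} (hw : ‖w‖ < ρ) :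
    w * deriv (fun z => ∑' k, c k * z ^ k) w = ∑' k : ℕ, (k : ℂ) ^ 1 * c k * w ^ k := by
  rw [(hasDerivAt_tsum_mul_pow hs hw).deriv, ← tsum_mul_left]
  refine tsum_congr fun k => ?_
  rcases Nat.eq_zero_or_pos k with rfl | hk
  · simp
  · rw [pow_one, show w ^ k = w ^ (k - 1) * w by rw [← pow_succ, Nat.sub_add_cancel hk]]
    ring

/-! ## The Euler-derivative recursion for pullbacks `P_i(ψ(z))`, `P_i(w) = Σ k^i c_k w^k` -/

section Recursion

variable {c : ℕ → ℂ} {ρ R₀ : ℝ} {ψ : ℂ → ℂ}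

/-- `P_i(w) := Σ_k k^i c_k w^k`. [folklore] -/
def eulerSeries (c : ℕ → ℂ) (i : ℕ) (w : ℂ) : ℂ := ∑' k : ℕ, (k : ℂ) ^ i * c k * w ^ k

/-- The pullback `g_i := P_i ∘ ψ`. [folklore] -/
def eulerPull (c : ℕ → ℂ) (ψ : ℂ → ℂ) (i : ℕ) (z : ℂ) : ℂ := eulerSeries c i (ψ z)

/-- The coefficients `k^i c_k` again have radius `≥ ρ'` for every `ρ' < ρ`. [folklore] -/
theorem summable_norm_eulerCoeff (hs : Summable fun k => ‖c k‖ * ρ ^ k) (i : ℕ)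
    {ρ' : ℝ} (hρ'0 : 0 ≤ ρ') (hρ' : ρ' < ρ) :
    Summable fun k : ℕ => ‖(k : ℂ) ^ i * c k‖ * ρ' ^ k := by
  have := summable_pow_mul_norm_mul_pow hρ'0 hρ' hs i
  refine this.congr fun k => ?_
  rw [norm_mul, norm_pow, Complex.norm_natCast]

/-- `HasSum (k^i c_k w^k) (P_i w)` for `‖w‖ < ρ`. [folklore] -/
theorem hasSum_eulerSeries (hs : Summable fun k => ‖c k‖ * ρ ^ k) (i : ℕ) {w : ℂ} (hw : ‖w‖ < ρ) :
    HasSum (fun k : ℕ => (k : ℂ) ^ i * c k * w ^ k) (eulerSeries c i w) :=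
  (summable_pow_mul_mul_pow hs i hw).hasSum

/-- **`θ P_i = P_{i+1}`** inside the disc: `w · P_i'(w) = P_{i+1}(w)`. [folklore] -/
theorem mul_deriv_eulerSeries (hs : Summable fun k => ‖c k‖ * ρ ^ k) (i : ℕ)
    {w : ℂ} (hw : ‖w‖ < ρ) :
    w * deriv (eulerSeries c i) w = eulerSeries c (i + 1) w := by
  obtain ⟨ρ', hwρ', hρ'ρ⟩ := exists_between hw
  have hρ'0 : 0 ≤ ρ' := (norm_nonneg w).trans hwρ'.le
  have hs' := summable_norm_eulerCoeff hs i hρ'0 hρ'ρ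
  have h1 := mul_deriv_tsum_mul_pow hs' hwρ'
  unfold eulerSeries
  rw [h1]
  refine tsum_congr fun k => ?_
  ring

/-- `P_i` is differentiable inside the disc, with the chain rule available. [folklore] -/
theorem hasDerivAt_eulerSeries (hs : Summable fun k => ‖c k‖ * ρ ^ k) (i : ℕ)
    {w : ℂ} (hw : ‖w‖ < ρ) :
    HasDerivAt (eulerSeries c i) (deriv (eulerSeries c i) w) w := by
  obtain ⟨ρ', hwρ', hρ'ρ⟩ := exists_between hw
  have hρ'0 : 0 ≤ ρ' := (norm_nonneg w).trans hwρ'.le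
  have hs' := summable_norm_eulerCoeff hs i hρ'0 hρ'ρ
  have h := hasDerivAt_tsum_mul_pow hs' hwρ'
  have : eulerSeries c i = fun z => ∑' k : ℕ, (k : ℂ) ^ i * c k * z ^ k := rfl
  rw [this]
  exact h.differentiableAt.hasDerivAt

variable (hR₀ : 0 < R₀) (hψ : DifferentiableOn ℂ ψ (ball (0 : ℂ) R₀)) (hψ0 : ψ 0 = 0)

include hR₀ hψ hψ0 in
/-- Near `0`, `‖ψ z‖ < ρ`. [folklore] -/
theorem eventually_norm_psi_lt (hρ : 0 < ρ) : ∀ᶠ z in 𝓝 (0 : ℂ), ‖ψ z‖ < ρ := by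
  have hc : ContinuousAt ψ 0 :=
    (hψ.differentiableAt (isOpen_ball.mem_nhds (mem_ball_self hR₀))).continuousAt
  have : ∀ᶠ z in 𝓝 (0 : ℂ), ψ z ∈ ball (0 : ℂ) ρ :=
    hc.preimage_mem_nhds (isOpen_ball.mem_nhds (by rw [hψ0]; exact mem_ball_self hρ))
  exact this.mono fun z hz => mem_ball_zero_iff.mp hz

include hR₀ hψ hψ0 in
/-- **The germs**: `HasSum (k^i c_k ψ(z)^k) (g_i z)` near `0`. [folklore] -/
theorem eventually_hasSum_eulerPull (hρ : 0 < ρ) (hs : Summable fun k => ‖c k‖ * ρ ^ k) (i : ℕ) :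
    ∀ᶠ z in 𝓝 (0 : ℂ), HasSum (fun k : ℕ => (k : ℂ) ^ i * c k * ψ z ^ k) (eulerPull c ψ i z) :=
  (eventually_norm_psi_lt hR₀ hψ hψ0 hρ).mono fun _ hz => hasSum_eulerSeries hs i hz

include hR₀ hψ hψ0 in
/-- **The Euler recursion for the pullbacks**: `g_{i+1} = ψ · g_i' / ψ'` near `0`
(where `ψ' ≠ 0`). [folklore] -/
theorem eventually_eulerPull_succ (hρ : 0 < ρ) (hs : Summable fun k => ‖c k‖ * ρ ^ k)
    (hψ'0 : deriv ψ 0 ≠ 0) (i : ℕ) :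
    ∀ᶠ z in 𝓝 (0 : ℂ), eulerPull c ψ (i + 1) z = ψ z * deriv (eulerPull c ψ i) z / deriv ψ z := by
  have hanal : AnalyticOnNhd ℂ ψ (ball (0 : ℂ) R₀) := hψ.analyticOnNhd isOpen_ball
  have hderc : ContinuousAt (deriv ψ) 0 :=
    (hanal.deriv 0 (mem_ball_self hR₀)).continuousAt
  have hne : ∀ᶠ z in 𝓝 (0 : ℂ), deriv ψ z ≠ 0 := hderc.eventually_ne hψ'0
  have hball : ∀ᶠ z in 𝓝 (0 : ℂ), z ∈ ball (0 : ℂ) R₀ := isOpen_ball.mem_nhds (mem_ball_self hR₀)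
  filter_upwards [eventually_norm_psi_lt hR₀ hψ hψ0 hρ, hne, hball] with z hz hz' hzb
  have hψd : HasDerivAt ψ (deriv ψ z) z := (hψ.differentiableAt (isOpen_ball.mem_nhds hzb)).hasDerivAt
  have hP : HasDerivAt (eulerSeries c i) (deriv (eulerSeries c i) (ψ z)) (ψ z) :=
    hasDerivAt_eulerSeries hs i hz
  have hcomp : deriv (eulerPull c ψ i) z = deriv (eulerSeries c i) (ψ z) * deriv ψ z := by
    have := hP.comp z hψd
    exact this.deriv
  rw [hcomp, eulerPull, ← mul_deriv_eulerSeries hs i hz]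
  field_simp

include hR₀ hψ hψ0 in
/-- **One step of the recursion for analytic representatives**: if `g_i = N/E` near `0` with
`N, E` analytic on the disc `|z| < R₀` and `E(0) ≠ 0`, then `g_{i+1} = N⁺/E⁺` near `0` with
`N⁺ = ψ (N'E − N E')`, `E⁺ = E² ψ'`, again analytic with `E⁺(0) ≠ 0`. [folklore] -/
theorem eulerPull_succ_rep (hρ : 0 < ρ) (hs : Summable fun k => ‖c k‖ * ρ ^ k)
    (hψ'0 : deriv ψ 0 ≠ 0) (i : ℕ) {N E : ℂ → ℂ}
    (hN : DifferentiableOn ℂ N (ball (0 : ℂ) R₀)) (hE : DifferentiableOn ℂ E (ball (0 : ℂ) R₀))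
    (hE0 : E 0 ≠ 0) (hrep : ∀ᶠ z in 𝓝 (0 : ℂ), eulerPull c ψ i z = N z / E z) :
    DifferentiableOn ℂ (fun z => ψ z * (deriv N z * E z - N z * deriv E z)) (ball (0 : ℂ) R₀) ∧
    DifferentiableOn ℂ (fun z => E z ^ 2 * deriv ψ z) (ball (0 : ℂ) R₀) ∧
    (fun z => E z ^ 2 * deriv ψ z) 0 ≠ 0 ∧
    ∀ᶠ z in 𝓝 (0 : ℂ), eulerPull c ψ (i + 1) z =
      (ψ z * (deriv N z * E z - N z * deriv E z)) / (E z ^ 2 * deriv ψ z) := by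
  have hNa : AnalyticOnNhd ℂ N (ball (0 : ℂ) R₀) := hN.analyticOnNhd isOpen_ball
  have hEa : AnalyticOnNhd ℂ E (ball (0 : ℂ) R₀) := hE.analyticOnNhd isOpen_ball
  have hψa : AnalyticOnNhd ℂ ψ (ball (0 : ℂ) R₀) := hψ.analyticOnNhd isOpen_ball
  have hN' : DifferentiableOn ℂ (deriv N) (ball (0 : ℂ) R₀) := hNa.deriv.differentiableOn
  have hE' : DifferentiableOn ℂ (deriv E) (ball (0 : ℂ) R₀) := hEa.deriv.differentiableOn
  have hψ' : DifferentiableOn ℂ (deriv ψ) (ball (0 : ℂ) R₀) := hψa.deriv.differentiableOn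
  refine ⟨hψ.mul ((hN'.mul hE).sub (hN.mul hE')), (hE.pow 2).mul hψ', ?_, ?_⟩
  · simp only [ne_eq, mul_eq_zero, pow_eq_zero_iff, OfNat.ofNat_ne_zero, not_false_eq_true,
      not_or]
    exact ⟨hE0, hψ'0⟩
  · have hEc : ContinuousAt E 0 :=
      (hE.differentiableAt (isOpen_ball.mem_nhds (mem_ball_self hR₀))).continuousAt
    have hEne : ∀ᶠ z in 𝓝 (0 : ℂ), E z ≠ 0 := hEc.eventually_ne hE0
    have hball : ∀ᶠ z in 𝓝 (0 : ℂ), z ∈ ball (0 : ℂ) R₀ := isOpen_ball.mem_nhds (mem_ball_self hR₀)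
    have hanal : AnalyticOnNhd ℂ ψ (ball (0 : ℂ) R₀) := hψ.analyticOnNhd isOpen_ball
    have hne : ∀ᶠ z in 𝓝 (0 : ℂ), deriv ψ z ≠ 0 :=
      (hanal.deriv 0 (mem_ball_self hR₀)).continuousAt.eventually_ne hψ'0
    -- the representation holds on a neighbourhood of each nearby point, so derivatives agree
    have hrep' : ∀ᶠ z in 𝓝 (0 : ℂ), eulerPull c ψ i =ᶠ[𝓝 z] fun z => N z / E z :=
      hrep.eventually_nhds
    filter_upwards [eventually_eulerPull_succ hR₀ hψ hψ0 hρ hs hψ'0 i, hrep', hEne, hball, hne]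
      with z hz hzrep hEz hzb hψz
    have hNd : HasDerivAt N (deriv N z) z := (hN.differentiableAt (isOpen_ball.mem_nhds hzb)).hasDerivAt
    have hEd : HasDerivAt E (deriv E z) z := (hE.differentiableAt (isOpen_ball.mem_nhds hzb)).hasDerivAt
    have hderiv : deriv (eulerPull c ψ i) z = (deriv N z * E z - N z * deriv E z) / E z ^ 2 := by
      rw [hzrep.deriv_eq]
      exact (hNd.div hEd hEz).deriv
    rw [hz, hderiv]
    field_simp

end Recursion

/-! ## Iterating the recursion: analytic representatives for all `g_i` -/

section Iterate

variable {c : ℕ → ℂ} {ρ R₀ : ℝ} {ψ G h : ℂ → ℂ}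

/-- The sequence of analytic representatives `(N_i, E_i)` with `g_i = N_i/E_i` near `0`:
`(N_0, E_0) = (G, h)`, `N_{i+1} = ψ (N_i' E_i − N_i E_i')`, `E_{i+1} = E_i² ψ'`. [folklore] -/
def repSeq (ψ G h : ℂ → ℂ) : ℕ → (ℂ → ℂ) × (ℂ → ℂ)
  | 0 => (G, h)
  | i + 1 =>
      (fun z => ψ z * (deriv (repSeq ψ G h i).1 z * (repSeq ψ G h i).2 z -
        (repSeq ψ G h i).1 z * deriv (repSeq ψ G h i).2 z),
       fun z => (repSeq ψ G h i).2 z ^ 2 * deriv ψ z)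

/-- **All `g_i` are quotients of analytic functions on the big disc**, with denominators
non-vanishing at `0`. [folklore] -/
theorem repSeq_spec (hR₀ : 0 < R₀) (hψ : DifferentiableOn ℂ ψ (ball (0 : ℂ) R₀)) (hψ0 : ψ 0 = 0)
    (hρ : 0 < ρ) (hs : Summable fun k => ‖c k‖ * ρ ^ k) (hψ'0 : deriv ψ 0 ≠ 0)
    (hG : DifferentiableOn ℂ G (ball (0 : ℂ) R₀)) (hh : DifferentiableOn ℂ h (ball (0 : ℂ) R₀))
    (hh0 : h 0 ≠ 0) (hrep0 : ∀ᶠ z in 𝓝 (0 : ℂ), eulerPull c ψ 0 z = G z / h z) (i : ℕ) :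
    DifferentiableOn ℂ (repSeq ψ G h i).1 (ball (0 : ℂ) R₀) ∧
    DifferentiableOn ℂ (repSeq ψ G h i).2 (ball (0 : ℂ) R₀) ∧
    (repSeq ψ G h i).2 0 ≠ 0 ∧
    ∀ᶠ z in 𝓝 (0 : ℂ), eulerPull c ψ i z = (repSeq ψ G h i).1 z / (repSeq ψ G h i).2 z := by
  induction i with
  | zero => exact ⟨hG, hh, hh0, hrep0⟩
  | succ i ih =>
      obtain ⟨hN, hE, hE0, hrep⟩ := ih
      exact eulerPull_succ_rep hR₀ hψ hψ0 hρ hs hψ'0 i hN hE hE0 hrep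

end Iterate

/-! ## A positive radius from the germ hypothesis -/

/-- If `Σ c_k ψ(z)^k` converges to `g(z)` near `0` and `ψ'(0) ≠ 0`, then `Σ ‖c_k‖ ρ^k < ∞` for
some `ρ > 0`. [folklore] -/
theorem exists_radius_of_germ {c : ℕ → ℂ} {ψ g : ℂ → ℂ}
    (hgerm : ∀ᶠ z in 𝓝 (0 : ℂ), HasSum (fun k => c k * ψ z ^ k) (g z)) (hψ'0 : deriv ψ 0 ≠ 0) :
    ∃ ρ : ℝ, 0 < ρ ∧ Summable fun k => ‖c k‖ * ρ ^ k := by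
  -- some point with `ψ z₀ ≠ 0` in the domain of convergence
  have hex : ∃ z, HasSum (fun k => c k * ψ z ^ k) (g z) ∧ ψ z ≠ 0 := by
    by_contra hcon
    push Not at hcon
    have h0 : ψ =ᶠ[𝓝 0] fun _ => (0 : ℂ) := hgerm.mono fun z hz => hcon z hz
    exact hψ'0 (by rw [h0.deriv_eq]; simp)
  obtain ⟨z₀, hz₀, hψz₀⟩ := hex
  set w₀ := ψ z₀ with hw₀
  have hsum : Summable fun k => c k * w₀ ^ k := hz₀.summable
  have hlim : Tendsto (fun k => ‖c k * w₀ ^ k‖) atTop (𝓝 0) := by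
    have := hsum.tendsto_atTop_zero
    simpa using this.norm
  obtain ⟨C, hC⟩ := hlim.bddAbove_range
  have hC' : ∀ k, ‖c k‖ * ‖w₀‖ ^ k ≤ C := fun k => by
    have := hC ⟨k, rfl⟩
    simp only [norm_mul, norm_pow] at this
    exact this
  have hw0 : 0 < ‖w₀‖ := norm_pos_iff.mpr hψz₀
  refine ⟨‖w₀‖ / 2, by positivity, ?_⟩
  have hC0 : 0 ≤ C := le_trans (by positivity) (hC' 0)
  refine Summable.of_nonneg_of_le (fun k => by positivity) (fun k => ?_)
    ((summable_geometric_two).mul_left C)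
  calc ‖c k‖ * (‖w₀‖ / 2) ^ k = ‖c k‖ * ‖w₀‖ ^ k * (1 / 2) ^ k := by
        rw [div_eq_mul_one_div, mul_pow]; ring
    _ ≤ C * (1 / 2) ^ k := mul_le_mul_of_nonneg_right (hC' k) (by positivity)

/-! ## The Euler operator on `ℚ⟦x⟧` and holonomicity -/

/-- The Euler operator `θ = x d/dx` on `ℚ⟦x⟧`: `θ(Σ u_k x^k) = Σ k u_k x^k`. [folklore] -/
def eulerOp (F : ℚ⟦X⟧) : ℚ⟦X⟧ := PowerSeries.mk fun k => (k : ℚ) * PowerSeries.coeff k F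

/-- `coeff_k (θ^i F) = k^i coeff_k F`. [folklore] -/
theorem coeff_eulerOp_iterate (F : ℚ⟦X⟧) (i k : ℕ) :
    PowerSeries.coeff k (eulerOp^[i] F) = (k : ℚ) ^ i * PowerSeries.coeff k F := by
  induction i generalizing F with
  | zero => simp
  | succ i ih =>
      rw [Function.iterate_succ_apply, ih, eulerOp, PowerSeries.coeff_mk]
      ring

/-- **Holonomic (D-finite) power series**: `F ∈ ℚ⟦x⟧` satisfies a nontrivial linear ODE
`Σ_{i<m} Pᵢ(x) θ^i F = 0` with polynomial coefficients, i.e. the family `(θ^i F)_{i<m}` is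
`ℚ[x]`-linearly dependent for some `m`. [cite: CalegariDimitrovTang2024, §2.6 Corollary 10 ("f is a holonomic function: there exists a nonzero linear differential operator L with ℚ[x]-coefficients that satisfies L(f) = 0") (p. 12)] -/
def IsHolonomic (F : ℚ⟦X⟧) : Prop :=
  ∃ m : ℕ, ¬ LinearIndependent (Polynomial ℚ) (fun i : Fin m => eulerOp^[i] F)

variable {r : ℕ}

/-- The Euler-derivative family of `F = Σ (a_k/den b k) x^k` has the same denominator type:
`θ^i F = fser b a'ᵢ` with `a' i k = k^i a k`. [folklore] -/
theorem fser_eulerFamily (b : Fin r → ℕ) (a : ℕ → ℤ) (m : ℕ) :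
    fser b (fun (i : Fin m) k => (k : ℤ) ^ (i : ℕ) * a k) =
      fun i : Fin m => eulerOp^[i] (PowerSeries.mk fun k => (a k : ℚ) / den b k) := by
  funext i
  ext k
  rw [coeff_eulerOp_iterate, fser, PowerSeries.coeff_mk, PowerSeries.coeff_mk, cfOf]
  push_cast
  ring

/-! ## André's holonomicity criterion (CDT Corollary 10) -/

/-- **The basic holonomy bound applied to the Euler family**: if `(θ^i f)_{i<m}` is
`ℚ(x)`-linearly independent then `m (log|ψ'(0)| − Σ b_j) ≤ 2 T(ψ)` (with `T(ψ)` the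
characteristic of `holonomyBound_nevanlinna_meromorphic`, `χ = 1`).
[cite: CalegariDimitrovTang2024, §2.6 Corollary 10 (p. 12); Appendix §17 (17.1)] -/
theorem eulerFamily_bound (b : Fin r → ℕ) (a : ℕ → ℤ) {ψ h G g : ℂ → ℂ} {R₀ : ℝ}
    (hR₀ : 1 < R₀) (hψ : DifferentiableOn ℂ ψ (ball (0 : ℂ) R₀)) (hψ0 : ψ 0 = 0)
    (hψ'0 : deriv ψ 0 ≠ 0)
    (hh : DifferentiableOn ℂ h (ball (0 : ℂ) R₀)) (hh0 : h 0 = 1)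
    (hG : DifferentiableOn ℂ G (ball (0 : ℂ) R₀))
    (hgerm : ∀ᶠ z in 𝓝 (0 : ℂ),
      HasSum (fun k => ((((a k : ℚ) / den b k : ℚ)) : ℂ) * ψ z ^ k) (g z))
    (hGg : ∀ᶠ z in 𝓝 (0 : ℂ), G z = h z * g z) (m : ℕ)
    (hind : LinearIndependent (Polynomial ℚ)
      (fun i : Fin m => eulerOp^[i] (PowerSeries.mk fun k => (a k : ℚ) / den b k))) :
    (m : ℝ) * (Real.log ‖deriv ψ 0‖ - ∑ j, (b j : ℝ)) ≤
      2 * (circleAverage (fun z => log⁺ ‖ψ z / (fun _ : ℂ => (1 : ℂ)) z‖) 0 1 +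
        ∑ᶠ x, ((MeromorphicOn.divisor (ψ / fun _ : ℂ => (1 : ℂ)) (closedBall (0 : ℂ) 1) x)⁻ : ℤ) *
          Real.log (‖x‖⁻¹)) := by
  have hR₀0 : 0 < R₀ := by linarith
  obtain ⟨c, hc⟩ : ∃ c : ℕ → ℂ, c = fun k => ((((a k : ℚ) / den b k : ℚ)) : ℂ) := ⟨_, rfl⟩
  -- a radius
  obtain ⟨ρ, hρ, hs0⟩ := exists_radius_of_germ hgerm hψ'0
  have hs : Summable fun k => ‖c k‖ * ρ ^ k := by subst hc; exact hs0
  -- `g = g_0` near `0`, hence `g_0 = G/h` near `0`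
  have hh0' : h 0 ≠ 0 := by rw [hh0]; exact one_ne_zero
  have hhc : ContinuousAt h 0 :=
    (hh.differentiableAt (isOpen_ball.mem_nhds (mem_ball_self hR₀0))).continuousAt
  have hhne : ∀ᶠ z in 𝓝 (0 : ℂ), h z ≠ 0 := hhc.eventually_ne hh0'
  have hrep0 : ∀ᶠ z in 𝓝 (0 : ℂ), eulerPull c ψ 0 z = G z / h z := by
    filter_upwards [hgerm, hGg, hhne, eventually_hasSum_eulerPull hR₀0 hψ hψ0 hρ hs 0]
      with z hz hzG hzh hz0
    have h1 : eulerPull c ψ 0 z = g z := by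
      refine hz0.unique ?_
      convert hz using 1
      funext k; simp [hc]
    rw [h1, hzG]; field_simp
  -- the analytic representatives `g_i = N_i / E_i`
  have hspec := repSeq_spec hR₀0 hψ hψ0 hρ hs hψ'0 hG hh hh0' hrep0
  obtain ⟨N, hN⟩ : ∃ N : ℕ → ℂ → ℂ, N = fun i => (repSeq ψ G h i).1 := ⟨_, rfl⟩
  obtain ⟨E, hE⟩ : ∃ E : ℕ → ℂ → ℂ, E = fun i => (repSeq ψ G h i).2 := ⟨_, rfl⟩
  have hND : ∀ i, DifferentiableOn ℂ (N i) (ball (0 : ℂ) R₀) := fun i => by rw [hN]; exact (hspec i).1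
  have hED : ∀ i, DifferentiableOn ℂ (E i) (ball (0 : ℂ) R₀) := fun i => by rw [hE]; exact (hspec i).2.1
  have hE0 : ∀ i, E i 0 ≠ 0 := fun i => by rw [hE]; exact (hspec i).2.2.1
  have hrep : ∀ i, ∀ᶠ z in 𝓝 (0 : ℂ), eulerPull c ψ i z = N i z / E i z := fun i => by
    rw [hN, hE]; exact (hspec i).2.2.2
  have hEc : ∀ i, ContinuousAt (E i) 0 := fun i =>
    ((hED i).differentiableAt (isOpen_ball.mem_nhds (mem_ball_self hR₀0))).continuousAt
  -- the Euler family as an instance of the bound's `fser`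
  obtain ⟨a', ha'⟩ : ∃ a' : Fin m → ℕ → ℤ, a' = fun (i : Fin m) (k : ℕ) => (k : ℤ) ^ (i : ℕ) * a k :=
    ⟨_, rfl⟩
  have hind' : LinearIndependent (Polynomial ℚ) (fser b a') := by
    rw [ha', fser_eulerFamily]; exact hind
  -- common denominator `H = Π_j E_j / Π_j E_j(0)` and numerators `G_i`
  obtain ⟨P0, hP0⟩ : ∃ P0 : ℂ, P0 = ∏ j : Fin m, E j 0 := ⟨_, rfl⟩
  have hP0ne : P0 ≠ 0 := by rw [hP0]; exact Finset.prod_ne_zero_iff.mpr fun j _ => hE0 j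
  obtain ⟨H, hH⟩ : ∃ H : ℂ → ℂ, H = fun z => (∏ j : Fin m, E j z) / P0 := ⟨_, rfl⟩
  obtain ⟨Gi, hGi⟩ : ∃ Gi : Fin m → ℂ → ℂ,
      Gi = fun (i : Fin m) (z : ℂ) => (∏ j ∈ Finset.univ.erase i, E j z) * N i z / P0 := ⟨_, rfl⟩
  have hH0 : H 0 = 1 := by rw [hH]; simp only; rw [← hP0]; exact div_self hP0ne
  have hprodD : DifferentiableOn ℂ (fun z => ∏ j : Fin m, E j z) (ball (0 : ℂ) R₀) :=
    DifferentiableOn.fun_finsetProd fun j _ => hED j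
  have hHc : ContinuousAt H 0 := by
    rw [hH]
    exact ((hprodD.differentiableAt (isOpen_ball.mem_nhds (mem_ball_self hR₀0))).continuousAt).div_const _
  have hGiD : ∀ i, DifferentiableOn ℂ (Gi i) (ball (0 : ℂ) R₀) := fun i => by
    have h1 : DifferentiableOn ℂ (fun z => ∏ j ∈ Finset.univ.erase i, E j z) (ball (0 : ℂ) R₀) :=
      DifferentiableOn.fun_finsetProd (u := Finset.univ.erase i) (f := fun j z => E j z)
        fun j _ => hED j
    have h2 : DifferentiableOn ℂ (fun z => (∏ j ∈ Finset.univ.erase i, E j z) * N i z / P0)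
        (ball (0 : ℂ) R₀) := (h1.mul (hND i)).div_const P0
    rw [hGi]; exact h2
  have hGig : ∀ i : Fin m, ∀ᶠ z in 𝓝 (0 : ℂ), Gi i z = H z * eulerPull c ψ i z := by
    intro i
    filter_upwards [hrep i, (hEc i).eventually_ne (hE0 i)] with z hz hEz
    rw [hz, hGi, hH]
    simp only
    rw [← Finset.mul_prod_erase Finset.univ (fun j : Fin m => E j z) (Finset.mem_univ i)]
    field_simp
  -- boundedness on the unit circle
  have hbd : ∀ i : Fin m, ∃ B : ℝ, ∀ z : ℂ, ‖z‖ = 1 → ‖Gi i z‖ ≤ B := by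
    intro i
    obtain ⟨B, hB⟩ := (isCompact_closedBall (0 : ℂ) 1).exists_bound_of_continuousOn
      ((hGiD i).continuousOn.mono (closedBall_subset_ball hR₀))
    exact ⟨B, fun z hz => hB z (mem_closedBall_zero_iff.mpr hz.le)⟩
  choose B hB using hbd
  have hGz : ∀ i (z : ℂ), ‖z‖ = 1 → ‖Gi i z‖ ≤ ∑ j, |B j| := fun i z hz =>
    (hB i z hz).trans ((le_abs_self _).trans
      (Finset.single_le_sum (fun j _ => abs_nonneg (B j)) (Finset.mem_univ i)))
  -- the germs in the bound's format
  have hgerm' : ∀ i : Fin m, ∀ᶠ z in 𝓝 (0 : ℂ),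
      HasSum (fun k => ((cfOf b a' i k : ℚ) : ℂ) * (ψ z / (fun _ : ℂ => (1 : ℂ)) z) ^ k)
        (eulerPull c ψ i z) := by
    intro i
    filter_upwards [eventually_hasSum_eulerPull hR₀0 hψ hψ0 hρ hs (i : ℕ)] with z hz
    convert hz using 1
    funext k
    simp only [div_one, cfOf, ha', hc]
    push_cast
    ring
  -- apply the basic holonomy bound with `χ = 1`
  have hbound := holonomyBound_nevanlinna_meromorphic' b a' hind' hR₀ hψ
    (differentiableOn_const (1 : ℂ)) hψ0 one_ne_zero (fun _ _ => one_ne_zero) hHc hH0 hGiD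
    hgerm' hGig hGz
  have hderiv : deriv (fun z => ψ z / (fun _ : ℂ => (1 : ℂ)) z) 0 = deriv ψ 0 := by
    congr 1; funext z; simp
  rw [hderiv] at hbound
  exact hbound

/-- **André's arithmetic holonomicity criterion** (Calegari–Dimitrov–Tang Corollary 10, after
André [cite: Andre1989]): if `f(x) = Σ_n a_n xⁿ/([1,…,b₁n]⋯[1,…,b_r n])`, `a_n ∈ ℤ`, admits an analytic
map `ψ` with `ψ(0) = 0` and `|ψ'(0)| > e^{b₁+⋯+b_r}` such that `f(ψ(z))` is meromorphic, then
`f` is holonomic. Here the analytic hypotheses are phrased as in the basic holonomy bound of this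
directory (`holonomyBound_nevanlinna_meromorphic'`): `ψ` analytic on a disc `|z| < R₀` with
`R₀ > 1`, and `f(ψ(z)) = G(z)/h(z)` near `0` with `G, h` analytic on that disc, `h(0) = 1`
(for `ψ` on the open unit disc one first rescales `z ↦ ψ(rz)`, `r ↑ 1`). Proof: the Euler
derivatives `θ^i f` have the same denominator type and pull back to `N_i/E_i` with
`N_{i+1} = ψ(N_i'E_i − N_iE_i')`, `E_{i+1} = E_i²ψ'`; if `(θ^i f)_{i<m}` were
`ℚ(x)`-independent the bound would give `m (log|ψ'(0)| − Σ b_j) ≤ 2 T(ψ)`, absurd for large `m`.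
[cite: CalegariDimitrovTang2024, §2.6 Corollary 10 (p. 12)] -/
theorem andre_holonomicity_criterion (b : Fin r → ℕ) (a : ℕ → ℤ) {ψ h G g : ℂ → ℂ} {R₀ : ℝ}
    (hR₀ : 1 < R₀) (hψ : DifferentiableOn ℂ ψ (ball (0 : ℂ) R₀)) (hψ0 : ψ 0 = 0)
    (hgap : ∑ j, (b j : ℝ) < Real.log ‖deriv ψ 0‖)
    (hh : DifferentiableOn ℂ h (ball (0 : ℂ) R₀)) (hh0 : h 0 = 1)
    (hG : DifferentiableOn ℂ G (ball (0 : ℂ) R₀))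
    (hgerm : ∀ᶠ z in 𝓝 (0 : ℂ),
      HasSum (fun k => ((((a k : ℚ) / den b k : ℚ)) : ℂ) * ψ z ^ k) (g z))
    (hGg : ∀ᶠ z in 𝓝 (0 : ℂ), G z = h z * g z) :
    IsHolonomic (PowerSeries.mk fun k => (a k : ℚ) / den b k) := by
  -- `ψ'(0) ≠ 0`
  have hσ0 : 0 ≤ ∑ j, (b j : ℝ) := Finset.sum_nonneg fun j _ => by positivity
  have hψ'0 : deriv ψ 0 ≠ 0 := by
    intro h0
    rw [h0, norm_zero, Real.log_zero] at hgap
    linarith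
  -- the constant of the bound and the gap
  obtain ⟨Cst, hCst⟩ : ∃ Cst : ℝ, Cst =
      2 * (circleAverage (fun z => log⁺ ‖ψ z / (fun _ : ℂ => (1 : ℂ)) z‖) 0 1 +
        ∑ᶠ x, ((MeromorphicOn.divisor (ψ / fun _ : ℂ => (1 : ℂ)) (closedBall (0 : ℂ) 1) x)⁻ : ℤ) *
          Real.log (‖x‖⁻¹)) := ⟨_, rfl⟩
  obtain ⟨gap, hgapdef⟩ : ∃ gap : ℝ, gap = Real.log ‖deriv ψ 0‖ - ∑ j, (b j : ℝ) := ⟨_, rfl⟩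
  have hgap0 : 0 < gap := by rw [hgapdef]; linarith
  refine ⟨⌊Cst / gap⌋₊ + 1, fun hind => ?_⟩
  have h1 := eulerFamily_bound b a hR₀ hψ hψ0 hψ'0 hh hh0 hG hgerm hGg _ hind
  rw [← hCst, ← hgapdef] at h1
  have h2 : Cst / gap < ((⌊Cst / gap⌋₊ + 1 : ℕ) : ℝ) := by
    push_cast; exact Nat.lt_floor_add_one _
  rw [div_lt_iff₀ hgap0] at h2
  linarith

/-- **André's criterion on the open unit disc** (the form printed in CDT Corollary 10): `ψ`
analytic on `|z| < 1` with `ψ(0) = 0`, `|ψ'(0)| > e^{Σ b_j}`, and `f(ψ(z)) = G(z)/h(z)` near `0`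
with `G, h` analytic on the unit disc, `h(0) = 1`. Reduced to `andre_holonomicity_criterion` by
the rescaling `z ↦ ψ(ϱ z)` with `ϱ < 1` so close to `1` that `ϱ |ψ'(0)| > e^{Σ b_j}`.
[cite: CalegariDimitrovTang2024, §2.6 Corollary 10 (p. 12)] -/
theorem andre_holonomicity_criterion_unitDisc (b : Fin r → ℕ) (a : ℕ → ℤ) {ψ h G g : ℂ → ℂ}
    (hψ : DifferentiableOn ℂ ψ (ball (0 : ℂ) 1)) (hψ0 : ψ 0 = 0)
    (hgap : ∑ j, (b j : ℝ) < Real.log ‖deriv ψ 0‖)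
    (hh : DifferentiableOn ℂ h (ball (0 : ℂ) 1)) (hh0 : h 0 = 1)
    (hG : DifferentiableOn ℂ G (ball (0 : ℂ) 1))
    (hgerm : ∀ᶠ z in 𝓝 (0 : ℂ),
      HasSum (fun k => ((((a k : ℚ) / den b k : ℚ)) : ℂ) * ψ z ^ k) (g z))
    (hGg : ∀ᶠ z in 𝓝 (0 : ℂ), G z = h z * g z) :
    IsHolonomic (PowerSeries.mk fun k => (a k : ℚ) / den b k) := by
  -- `ψ'(0) ≠ 0` and a scaling factor `ϱ ∈ (0,1)` with `Σ b_j < log(ϱ |ψ'(0)|)`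
  have hσ0 : 0 ≤ ∑ j, (b j : ℝ) := Finset.sum_nonneg fun j _ => by positivity
  have hd0 : 0 < ‖deriv ψ 0‖ := by
    by_contra hle
    push Not at hle
    have : ‖deriv ψ 0‖ = 0 := le_antisymm hle (norm_nonneg _)
    rw [this, Real.log_zero] at hgap
    linarith
  -- `exp(Σ b) < |ψ'(0)|`, so `ϱ := (exp(Σ b)/|ψ'(0)| + 1)/2 ∈ (exp(Σ b)/|ψ'(0)|, 1)`
  set q : ℝ := Real.exp (∑ j, (b j : ℝ)) / ‖deriv ψ 0‖ with hq
  have hq1 : q < 1 := by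
    rw [hq, div_lt_one hd0, ← Real.log_lt_log_iff (Real.exp_pos _) hd0, Real.log_exp]
    exact hgap
  have hq0 : 0 < q := by rw [hq]; positivity
  set ϱ : ℝ := (q + 1) / 2 with hϱ
  have hϱ0 : 0 < ϱ := by rw [hϱ]; linarith
  have hϱ1 : ϱ < 1 := by rw [hϱ]; linarith
  have hqϱ : q < ϱ := by rw [hϱ]; linarith
  -- the rescaled data on the disc of radius `R₀ = 1/ϱ > 1`
  set R₀ : ℝ := 1 / ϱ with hR₀
  have hR₀1 : 1 < R₀ := by rw [hR₀, lt_div_iff₀ hϱ0]; linarith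
  have hmaps : MapsTo (fun z : ℂ => (ϱ : ℂ) * z) (ball (0 : ℂ) R₀) (ball (0 : ℂ) 1) := by
    intro z hz
    rw [mem_ball_zero_iff] at hz ⊢
    rw [norm_mul, Complex.norm_real, Real.norm_of_nonneg hϱ0.le]
    calc ϱ * ‖z‖ < ϱ * R₀ := mul_lt_mul_of_pos_left hz hϱ0
      _ = 1 := by rw [hR₀]; field_simp
  have hsc : DifferentiableOn ℂ (fun z : ℂ => (ϱ : ℂ) * z) (ball (0 : ℂ) R₀) :=
    (differentiableOn_const _).mul differentiableOn_id
  have hψ' : DifferentiableOn ℂ (fun z => ψ ((ϱ : ℂ) * z)) (ball (0 : ℂ) R₀) := hψ.comp hsc hmaps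
  have hh' : DifferentiableOn ℂ (fun z => h ((ϱ : ℂ) * z)) (ball (0 : ℂ) R₀) := hh.comp hsc hmaps
  have hG' : DifferentiableOn ℂ (fun z => G ((ϱ : ℂ) * z)) (ball (0 : ℂ) R₀) := hG.comp hsc hmaps
  -- derivative at `0`: `ϱ ψ'(0)`
  have hψd : DifferentiableAt ℂ ψ 0 := hψ.differentiableAt (isOpen_ball.mem_nhds (mem_ball_self one_pos))
  have hderiv : deriv (fun z => ψ ((ϱ : ℂ) * z)) 0 = (ϱ : ℂ) * deriv ψ 0 := by
    have h1 : HasDerivAt (fun z : ℂ => (ϱ : ℂ) * z) (ϱ : ℂ) 0 := by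
      simpa using (hasDerivAt_id (0 : ℂ)).const_mul (ϱ : ℂ)
    have h2 : HasDerivAt ψ (deriv ψ 0) ((ϱ : ℂ) * 0) := by rw [mul_zero]; exact hψd.hasDerivAt
    have h3 : HasDerivAt (fun z => ψ ((ϱ : ℂ) * z)) (deriv ψ 0 * (ϱ : ℂ)) 0 := h2.comp 0 h1
    rw [h3.deriv]; ring
  have hgap' : ∑ j, (b j : ℝ) < Real.log ‖deriv (fun z => ψ ((ϱ : ℂ) * z)) 0‖ := by
    rw [hderiv, norm_mul, Complex.norm_real, Real.norm_of_nonneg hϱ0.le,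
      ← Real.exp_lt_exp, Real.exp_log (mul_pos hϱ0 hd0)]
    -- `exp(Σ b) = q |ψ'(0)| < ϱ |ψ'(0)|`
    have : Real.exp (∑ j, (b j : ℝ)) = q * ‖deriv ψ 0‖ := by rw [hq]; field_simp
    rw [this]
    exact mul_lt_mul_of_pos_right hqϱ hd0
  -- germs transported along `z ↦ ϱ z` (continuous, fixing `0`)
  have htend : Tendsto (fun z : ℂ => (ϱ : ℂ) * z) (𝓝 0) (𝓝 0) := by
    have : Continuous fun z : ℂ => (ϱ : ℂ) * z := continuous_const.mul continuous_id
    simpa using this.tendsto 0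
  have hgerm' : ∀ᶠ z in 𝓝 (0 : ℂ), HasSum (fun k => ((((a k : ℚ) / den b k : ℚ)) : ℂ) *
      ψ ((ϱ : ℂ) * z) ^ k) (g ((ϱ : ℂ) * z)) := htend.eventually hgerm
  have hGg' : ∀ᶠ z in 𝓝 (0 : ℂ), G ((ϱ : ℂ) * z) = h ((ϱ : ℂ) * z) * g ((ϱ : ℂ) * z) :=
    htend.eventually hGg
  exact andre_holonomicity_criterion b a hR₀1 hψ' (by simp [hψ0]) hgap' hh' (by simp [hh0]) hG'
    hgerm' hGg'

/-- The scalar action of `ℚ[x]` on `ℚ⟦x⟧` is multiplication by the coerced polynomial. [folklore] -/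
theorem polynomial_smul_eq (p : Polynomial ℚ) (F : ℚ⟦X⟧) : p • F = (p : ℚ⟦X⟧) * F := by
  rw [Algebra.smul_def, PowerSeries.algebraMap_apply', Algebra.algebraMap_self, PowerSeries.map_id]
  rfl

/-- **Holonomic = a nontrivial linear ODE in `θ`**: `IsHolonomic F` iff there are polynomials
`P₀,…,P_{m−1}`, not all zero, with `Σ_{i<m} Pᵢ · θ^i F = 0`. [folklore] -/
theorem isHolonomic_iff_exists_ode (F : ℚ⟦X⟧) :
    IsHolonomic F ↔ ∃ (m : ℕ) (P : Fin m → Polynomial ℚ), P ≠ 0 ∧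
      ∑ i, (P i : ℚ⟦X⟧) * (eulerOp^[i] F) = 0 := by
  constructor
  · rintro ⟨m, hm⟩
    rw [Fintype.not_linearIndependent_iff] at hm
    obtain ⟨c, hc, i, hi⟩ := hm
    refine ⟨m, c, fun h0 => hi (by rw [h0]; rfl), ?_⟩
    simpa [polynomial_smul_eq] using hc
  · rintro ⟨m, P, hP, hsum⟩
    refine ⟨m, fun hind => hP ?_⟩
    rw [Fintype.linearIndependent_iff] at hind
    funext i
    exact hind P (by simpa [polynomial_smul_eq] using hsum) i

/-- Example (non-vacuity): the zero series is holonomic (`1 · θ⁰ 0 = 0`). [folklore] -/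
example : IsHolonomic (0 : ℚ⟦X⟧) := by
  refine ⟨1, fun h => ?_⟩
  have := h.ne_zero 0
  simp at this

end HolonomyBound

end Literature.NumberTheory.Transcendental
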